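import Literature.MathematicalPhysics.QuantumFieldTheory.Balaban1983to89.B8SockP5uEBodyNestedSrcPer
import Literature.MathematicalPhysics.QuantumFieldTheory.Balaban1983to89.B8SockWindowsSrc
import Literature.MathematicalPhysics.QuantumFieldTheory.Balaban1983to89.B8SockP5uEProviderGamma
import Literature.MathematicalPhysics.QuantumFieldTheory.Balaban1983to89.B8TowerBondsPrinted
import Literature.MathematicalPhysics.QuantumFieldTheory.Balaban1983to89.T4TermwiseTorus

/-!
# `Balaban1983to89.B8SockSP5uNestedSrcPer` — [Balaban1985RegularSpaces] Prop. 5 (1.109) p. 94 for Theorem 4's datum (p. 95) at NESTED members ON THE TORUS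
# (§3 p. 98), AT THEOREM 8's SOURCED GAUGE CONDITION (1.146) p. 101: the N05 knit's uniqueness socket `SP5u` SERVED at nested periodic members for a GENERAL
# gauge predicate implying the multiplier form of (1.146) with a periodic source — bricks U2″ (provider) + U3″ (member-indexed server) of the interface request
# B8-P5-NESTED-SERVER (uniqueness half), instance (ii)

statement-level skeleton of published theorems with citation tags; proofs where landed; nothing here is a claim about the Yang–Mills mass gap

T. Bałaban, *Spaces of regular gauge field configurations on a lattice and gauge fixing conditions*, Commun. Math. Phys. **99** (1985) 75–102
`[Balaban1985RegularSpaces]` ("B8"; printed page = PDF page + 74): Prop. 5 (1.107)–(1.109) p. 94 («There exist positive constants c₂, c₃, depending on d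
and L only … exactly one function λ′ … Such a configuration u′ is unique in the domain |λ|, |Dλ|₍₋₁₎ < c₃»), Thm 4 p. 88 and p. 95 (the uniqueness paragraph),
Thm 8 (1.146) p. 101 («there exists exactly one gauge transformation u …»), (1.5)–(1.6) p. 77, (1.31) + (1.35) p. 82, p. 77 (one-end-point bonds; «we admit the
case when some domains Ω_j are equal to T_η»), (1.29) p. 81, (1.57)–(1.62) pp. 86–87, §3 p. 98.  T. Bałaban, *Propagators for lattice gauge theories in a background
field*, CMP **99** (1985) 389–434 `[Balaban1985BackgroundPropagators]` ("[4]"): Thm 3.1 p. 397, (3.24)–(3.25) p. 394, Thm 3.3 p. 398.  `[Balaban1985Averaging]`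
("[3]"): (4) p. 18 (the torus `T_η` as `P`-periodic data on `ηℤᵈ`).  PDF held: `paper:balaban1985-cmp99-regular-spaces-gauge-fixing`.  STATUS: published,
refereed.

CITATION HEADER (lean-in-tree rule).  Cell `lit-balaban`, seat `lit-balaban-p21` (gen 39), sub-row «G-B8-T2S» (R3 `stmt-QuantumFields-19200`, `--supports`, helper;
the consumers bear on `stmt-QuantumFields-27364`).  INTERFACE REQUEST B8-P5-NESTED-SERVER (pub-ymgap dag-n05-c g17 → lit-balaban, 2026-08-28; pub-ymgap INBOX
l.41793, lead's answer l.41923; commission `lit-balaban-p21/WAKE-B8P5NestedServerUniq.md`), instance (ii) «Theorem 8's source»: the consumers instantiate T5's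
abstract binders as `Φ := Site d → 𝔸`, `Adm a f U₀ a0 b0 := ((InR138 … ∧ Hermitian ∧ support ∧ Bdd) ∧ IsPeriodic (p a) f) ∧ msup … f < γ(a0+b0)`,
`LanF a U₀ f m W ↔ IsLandau146W L m η (Ω 0) (Λs m) U₀ f W`.

WHAT THIS FILE PROVES (two theorems, no `def`) — this seat's zero-source file `B8SockSP5uNestedPer` VERBATIM with dag-n05-w4's sourced `ℤᵈ` road
(`B8SockSP5uProviderSrcGammaPrime` ∕ `B8SockSP5UniformThresholdsSrcGammaPrime.exists_uniform_threshold_sp5u_src_γ'`) merged in token for token, at a GENERAL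
source-reading `src : Φ → (Site d → 𝔸)` of the knit's abstract `Φ`.
(U2″) `sp5u_of_lettersUB_src_γ'_per` — T5's `SP5u` binder text at ONE nested periodic `Ω 0 = univ` member FROM: (a) the supplier `SLetUBper` of [4]'s uniqueness
letters at PERIODIC backgrounds (as in U2); the knit's admissibility handing the source's size `< γ(α₀ + α₁)` in the `(−2)`-weighted sup norm on the `Ω_j` with
its `Bdd` certificate and the source's `P`-periodicity (`hAdm`); the knit's gauge predicate implying THE MULTIPLIER FORM OF (1.146) at the top level (`hLan146`:
`LanF U₀ φ k W → ∃ μ, Δ↾Ω₀[D*((iη)⁻¹ log W) − src φ] = Q′ᵀμ`); (b) T5's OWN guarded sourced b9 socket `SH59src`; (c) the windows family `hwin` (the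
consequent of `B8SockWindowsSrc.uniqWindows_of_guard_src` at source size `γ`: smallness windows at `hE₂ + γ(α₀ + α₁)∕2`, `c_{DA} = 2dL²c⋆₈`) and (d) `hwinγ`.
Proof: the source's `Bd2` size from `Bdd` + the norm premiss (dag-n05-w4's eight lines), then U1″ `B8SockP5uEBodyNestedSrcPer.sockP5uE_body_src_γ'_per`.
(U3″) ★★★ `sockP5uSrcPer_of_lettersAtPerNested` — `∃ cu cP : ℝ, 0 < cu ∧ 0 < cP ∧ …` FIRST, functions of `(d, L, B₈, B₀′ᴴ, B₂′, B_G, B_R, γ, c_L, c₅₉)` only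
(`cu` := the radius of `uniqWindows_of_guard_src` at source size `γ` — print's `c₃`; `cP := min(c_W, c_L, c₅₉, c_γ)` — print's `c₂`), THEN for every member
`i : ZdIdx d L`, every period `P : ℕ`, every `Φ`, `Adm`, `LanF`, `src` with `hAdm`, `hLan146` at `i`, under the three laws of the periodic (1.5)-index, the
supplier (a) at `(i, P)` and T5's `SH59src` text at `(i, P)` below `c₅₉`: **T5's `SP5u` binder text :174–:194 at `(i, P)` VERBATIM**.

HONEST SCOPE ∕ A6.  By-name re-assembly; 0 new estimates; Proposition 5 ∕ Theorem 8 ∕ [4] ∕ Sect. E NOT re-proved; [4]'s letters (with their laws at periodic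
arguments) and the knit's sourced b9 socket are HYPOTHESES (N06 content at nested members); no joint-satisfiability claim; `d ≥ 2`, `L ≥ 2`.  Count-neutral;
N05 NOT discharged; one finite `𝕋⁴` programme at fixed `ε`, Bałaban as printed; the Yang–Mills mass gap (Clay) is NOT proved by any of this — nothing continuum
∕ ℝ⁴ ∕ OS.  No `sorry`, no `def`, no `… : Prop` fact, no `instance`, no `notation`.

RELATED IN THE TREE, NOT DUPLICATED: `B8SockSP5uNestedPer` (this seat; zero-source twin, instance (i)), `B8SockSP5uProviderSrcGammaPrime` ∕
`B8SockSP5UniformThresholdsSrcGammaPrime` (dag-n05-w4; the `ℤᵈ` sourced γ′ road), `B8SockP5uEBodyNestedSrcPer` (this seat; U1″, USED), `B8SockWindowsSrc` ∕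
`B8SockP5uEProviderGamma` (windows; USED).
-/

noncomputable section

open NormedSpace

namespace Literature.MathematicalPhysics.QuantumFieldTheory.Balaban1983to89.B8SockSP5uNestedSrcPer

open Complex (I)
open MatrixLog B7Prop1Explicit B7Prop2Explicit B7Prop1Local B7Eq92Concrete
open B7Prop2Explicit (C0 c2')
open B7Prop3Flat (c3)
open B7Prop10General (C6 C4G)
open B7Prop9Flat (C5')
open B7Eq78Linearization (conjR zdBlocking QprimeIter)
open B8Ineq132 (covDerivFwd covDeriv InAk)
open B8Eq119TwistedAxial (Restr129 InAx bgT)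
open B8Eq184Proof (gaugeExp cfgExp)
open B8Lemma1NonAbelian (mulCfg)
open B8Eq140Level (SideTouches)
open B8Eq146AExpansion (iEta expCfg)
open B8Ineq130 (tlo thi)
open B8Thm2LogB (blockTop)
open B8Eq138LandauZd (IsLandau138W IsLandau146W covDivB covLap QT logCfg)
open B8Ineq125Concrete (C2p)
open B8Eq1117Concrete (XSpace)
open B8Eq155JBound (Jcur wsup wsup_nonneg)
open B7Prop4GeneralLevels (linCovIter)
open B8ScaledSupNorm (bondNorm msup Bdd msup_nonneg weight_mul_norm_le_msup weight_neg_natCast)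
open B8Prop5ContractionKLevel (Bd2 Mc Kc)
open B8LambdaSpaceKLevel (wt)
open B8Thm4AtLandau138 (mgauge_mgauge_inv)
open B8Thm2TorusSupplier (mgauge_periodic)
open B8SockP5uEBodyNestedSrcPer (sockP5uE_body_src_γ'_per)
open B8SockWindowsSrc (uniqWindows_of_guard_src)
open B8SockP5uEProviderGamma (gammaWindows_of_guard)
open B8LeafModelZd (ZdIdx)
open B8TowerBondsPrinted (towerBondsP)
open T4TermwiseTorus (IsPeriodic)

-- `Site` alone could resolve to the torus sites of `Setup.lean`; re-export the `ℤ^d` sites of `B7Prop1Explicit`.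
export B7Prop1Explicit (Site)

variable {d : ℕ} {𝔸 : Type*} [CStarAlgebra 𝔸] [Nontrivial 𝔸]

/-! ## §1 (U2″) The provider at one member given as raw data: letters, the source's admissibility, the knit's sourced b9 socket and the windows displayed -/

section Provider

variable {L : ℕ} {η : ℝ} {k : ℕ} {Ω : ℕ → Set (Site d)} {Λs : ℕ → ℕ → Set (Site d)} {Λb : ℕ → ℕ → Set (Site d × Fin d)}
  {B₀ B₀' B₈ B₀'H B₂' BG BR cL cP γ γ' α₄ cu : ℝ}

/-- ★ **THE KNIT's UNIQUENESS SOCKET `SP5u` (E CURRENCY, PERIODICITY-GUARDED) AT ONE NESTED PERIODIC `Ω 0 = univ` MEMBER, THEOREM 8's SOURCE, PROVIDED**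
(Prop. 5 (1.109) p. 94 used as on p. 95 at Theorem 8's gauge condition (1.146) p. 101, on the torus §3 p. 98; the periodic twin of dag-n05-w4's
`B8SockSP5uProviderSrcGammaPrime.sp5uE_of_lettersUB_src_γ'`, this seat's zero-source `B8SockSP5uNestedPer.sp5u_of_lettersUB_γ'_per` VERBATIM otherwise): at a
member `(η, k, Ω, Λs, Λb)` with `Ω 0 = univ`, class law «box ⊂ Ω_{j−1}», tower law at truncation `k`, period `P` with `Lᵏ ∣ P` and shift-invariant `Λ_j` —
T5's `SP5u` binder text, FROM: the supplier `SLetUBper` of [4]'s uniqueness letters at PERIODIC backgrounds ((U1)∕(U2)∕(1.91) at periodic arguments, (P) laws);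
the knit's ABSTRACT admissibility `Adm` handing, for the source `src φ` of an admitted `φ`, its size `< γ(α₀ + α₁)` in the `(−2)`-weighted sup norm on the
`Ω_j` (with its `Bdd` certificate) and its `P`-periodicity (`hAdm`); the knit's ABSTRACT gauge predicate `LanF` implying THE MULTIPLIER FORM OF (1.146) with
source `src φ` at the top level (`hLan146`); T5's OWN guarded sourced b9 socket `SH59` at this member; the displayed windows `hwin` (source size `γ`: smallness
windows at `hE₂ + γ(α₀ + α₁)∕2`, `c_{DA} = 2dL²c⋆₈`) and `hwinγ`.  Proof: `|src φ|₍₋₂₎ ≤ γ(α₀ + α₁)` on the `Ω_j` from `Bdd` and the norm premiss, then U1″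
`sockP5uE_body_src_γ'_per` at `B₀ := B₈`, `Lan := LanF U₀ φ`, `Sa = Sg := γ′B₀(α₀ + α₁)`, `f := src φ`, `m_f := γ(α₀ + α₁)`.
[cite: Balaban1985RegularSpaces, Prop. 5 (1.109) p.94, Thm 4 p.88 («exactly one»), p.95, Thm 8 (1.146) p.101, (1.29) p.81, (1.35) p.82, p.77, (1.57)–(1.62) pp.86–87, §3 p.98; Balaban1985Averaging, (4) p.18; Balaban1985BackgroundPropagators, Thm 3.1 p.397, Thm 3.3 p.398] -/
theorem sp5u_of_lettersUB_src_γ'_per (hd2 : 2 ≤ d) (hL : 2 ≤ L) (hη : 0 < η) (hk : 1 ≤ k) (P : ℕ) (hΩ : ∀ j, Ω (j + 1) ⊆ Ω j) (hΩ0 : Ω 0 = Set.univ)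
    -- PRINT's box law: the locality box of a class bond of level `j` lies in `Ω_{j−1}` ((1.31); level 0: `Ω₀`)
    (hbox : ∀ m, m ≤ k → ∀ j, j ≤ m → ∀ c ∈ Λb m j, ∀ x, InBox (loK L j c.1) (bondHiK L j c.1 c.2) x → x ∈ Ω (j - 1))
    (hclass : ∀ m, m ≤ k → ∀ j, j ≤ m → ∀ c ∈ Λb m j,
      (c.1 ∈ Λs m j ∧ c.1 + e c.2 ∈ Λs m j) ∨
      (∃ j', j = j' + 1 ∧ (∀ x, (L : ℤ) • c.1 ≤ x → x ≤ (L : ℤ) • c.1 + blockTop L → x ∈ Λs m j') ∧ c.1 + e c.2 ∈ Λs m j) ∨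
      (∃ j', j = j' + 1 ∧ c.1 ∈ Λs m j ∧ (∀ x, (L : ℤ) • (c.1 + e c.2) ≤ x → x ≤ (L : ℤ) • (c.1 + e c.2) + blockTop L → x ∈ Λs m j')))
    (htower : ∀ j, j ≤ k → ∀ y ∈ Λs k j, ∀ x, InBox (tlo L y j) (thi L y j) x → x ∈ Ω j)
    -- the torus (§3 p. 98): `Lᵏ ∣ P`, the constraint sets `Λ_j` of truncation `k` are invariant under the period shifts `+ (P∕Lʲ) • e ι`
    (hPdiv : ((L : ℤ) ^ k ∣ (P : ℤ)))
    (hΛ : ∀ j, j ≤ k → ∀ (y : Site d) (ι : Fin d), y + ((P : ℤ) / (L : ℤ) ^ j) • e ι ∈ Λs k j ↔ y ∈ Λs k j)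
    (hB₀ : 0 < B₀) (hB₀' : 0 < B₀') (hB₀'H : 0 < B₀'H) (hB₂' : 0 ≤ B₂') (hBG : 0 ≤ BG) (hBR : 0 ≤ BR) (hγ : 0 ≤ γ) (hγ' : 0 ≤ γ')
    (hB₀8 : B₀ ≤ B₈) (hγB : 5 * (d : ℝ) * L * B₀ + 2 * (γ' * B₀) ≤ 5 * (d : ℝ) * L * B₈) (hα₄ : 0 < α₄)
    -- (a) ONE SUPPLIER of [4]'s uniqueness letters at the top structure `(k, Λs k, U₀)` for PERIODIC backgrounds: (U1)∕(U2)∕(1.91) at periodic arguments, (P) laws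
    (SLetUBper : ∀ α₀ : ℝ, 0 < α₀ → α₀ ≤ cL → ∀ U₀ : Site d → Fin d → 𝔸ˣ, (∀ x κ, U₀ x κ ∈ unitaryUnits 𝔸) → IsPeriodic P U₀ → InAk L k η α₀ Ω U₀ →
      ∃ (g Δ : (Site d → 𝔸) →ₗ[ℂ] (Site d → 𝔸)) (q : (Site d → 𝔸) →ₗ[ℂ] (ℕ → Site d → 𝔸)) (qs : (ℕ → Site d → 𝔸) →ₗ[ℂ] (Site d → 𝔸))
        (Aw c : (ℕ → Site d → 𝔸) →ₗ[ℂ] (ℕ → Site d → 𝔸)) (H' : XSpace d k 𝔸 →ₗ[ℂ] (Site d → 𝔸)),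
        (∀ x : Site d → 𝔸, (∀ (z : Site d) (ι : Fin d), x (z + (P : ℤ) • e ι) = x z) → (∃ C : ℝ, ∀ y, ‖x y‖ ≤ C) →
          g (Δ x + qs (Aw (q x))) = x) ∧
        (∀ φ : ℕ → Site d → 𝔸, (∀ j, j ≤ k → ∀ (y : Site d) (ι : Fin d), φ j (y + ((P : ℤ) / (L : ℤ) ^ j) • e ι) = φ j y) →
          qs (c (q (g (g (qs φ))))) = qs φ) ∧
        (∀ (f : Site d → 𝔸), ∀ x ∈ Ω 0, Δ f x = covLap η U₀ ((Ω 0).indicator f) x) ∧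
        (∀ (μ : ℕ → Site d → 𝔸), ∀ x ∈ Ω 0, qs μ x = QT L k (Λs k) U₀ μ x) ∧
        (∀ (f : Site d → 𝔸) (j : ℕ), j ≤ k → ∀ y ∈ Λs k j, q f j y = QprimeIter (zdBlocking d L) (bgT L U₀) j f y) ∧
        (∀ (f : Site d → 𝔸) (j : ℕ) (y : Site d), ¬ (j ≤ k ∧ y ∈ Λs k j) → q f j y = 0) ∧
        (∀ (f : Site d → 𝔸) (z : Site d) (ι : Fin d), g f (z + (P : ℤ) • e ι) = g f z) ∧
        (∀ μ : ℕ → Site d → 𝔸, ∀ j, j ≤ k → ∀ (y : Site d) (ι : Fin d), Aw μ j (y + ((P : ℤ) / (L : ℤ) ^ j) • e ι) = Aw μ j y) ∧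
        (∀ (X : XSpace d k 𝔸) (x : Site d), ‖H' X x‖ ≤ B₀'H * ‖X‖) ∧
        (∀ j, j ≤ k → ∀ (X : XSpace d k 𝔸), ∀ p ∈ {b : Site d × Fin d | SideTouches (Ω j) b.1 b.2},
          wt L η j * ‖covDerivFwd η U₀ p.2 (H' X) p.1‖ ≤ B₀'H * ‖X‖) ∧
        (∀ X : XSpace d k 𝔸, Bd2 L η k Ω (covLap η U₀ (H' X)) (B₂' * ‖X‖)) ∧
        (∀ X : XSpace d k 𝔸, (∀ (p : Fin (k + 1) × Site d) (ι : Fin d), X (p.1, p.2 + ((P : ℤ) / (L : ℤ) ^ (p.1 : ℕ)) • e ι) = X p) →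
          ∀ (z : Site d) (ι : Fin d), H' X (z + (P : ℤ) • e ι) = H' X z) ∧
        (∀ (Y : XSpace d k 𝔸), (∀ (p : Fin (k + 1) × Site d) (ι : Fin d), Y (p.1, p.2 + ((P : ℤ) / (L : ℤ) ^ (p.1 : ℕ)) • e ι) = Y p) →
          ∀ (j : ℕ) (hj : j ≤ k) (y : Site d), y ∈ Λs k j →
          QprimeIter (zdBlocking d L) (bgT L U₀) j (H' Y) y = Y (⟨j, Nat.lt_succ_of_le hj⟩, y)) ∧
        (∀ (f : Site d → 𝔸) (r : ℝ), 0 ≤ r → Bd2 L η k Ω f r →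
          (∀ x, ‖g f x‖ ≤ BG * r) ∧ ∀ j, j ≤ k → ∀ p ∈ {b : Site d × Fin d | SideTouches (Ω j) b.1 b.2},
            wt L η j * ‖covDerivFwd η U₀ p.2 (g f) p.1‖ ≤ BG * r) ∧
        (∀ (f : Site d → 𝔸) (r : ℝ), 0 ≤ r → Bd2 L η k Ω f r → Bd2 L η k Ω (f - g (qs (c (q (g f))))) (BR * r)))
    (hcPL : cP ≤ cL)
    -- the admissibility and gauge predicates of the knit, ABSTRACT, read through a source map `src : Φ → (Site d → 𝔸)`: admissibility hands the source's size
    -- `< γ(α₀ + α₁)` in the `(−2)`-weighted sup norm on the `Ω_j` (with its `Bdd` certificate) and its `P`-periodicity; the gauge predicate implies THE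
    -- MULTIPLIER FORM OF (1.146) with that source at the top level (instance (ii): projections of the knit's `Adm`; `IsLandau146W`'s second clause)
    {Φ : Type*} (Adm : Φ → (Site d → Fin d → 𝔸ˣ) → ℝ → ℝ → Prop) (LanF : (Site d → Fin d → 𝔸ˣ) → Φ → ℕ → (Site d → Fin d → 𝔸ˣ) → Prop)
    (src : Φ → Site d → 𝔸)
    (hAdm : ∀ (φ : Φ) (U₀ : Site d → Fin d → 𝔸ˣ) (α₀ α₁ : ℝ), Adm φ U₀ α₀ α₁ →
      (Bdd L k η (-(2 : ℝ)) (fun j (x : Site d) => x ∈ Ω j) (src φ) ∧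
        msup L k η (-(2 : ℝ)) (fun j (x : Site d) => x ∈ Ω j) (src φ) < γ * (α₀ + α₁)) ∧ IsPeriodic P (src φ))
    (hLan146 : ∀ (U₀ : Site d → Fin d → 𝔸ˣ) (φ : Φ) (W : Site d → Fin d → 𝔸ˣ), LanF U₀ φ k W →
      ∃ μ : ℕ → Site d → 𝔸, ∀ x ∈ Ω 0, covLap η U₀ ((Ω 0).indicator (covDivB η U₀ (logCfg η W) - src φ)) x = QT L k (Λs k) U₀ μ x)
    -- (b) THE KNIT's OWN SOURCED b9 SOCKET `SH59src` AT THIS MEMBER, PERIODICITY-GUARDED (T5's binder text :150–:173, class `Λb`)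
    (SH59 : ∀ α₀ α₁ : ℝ, 0 < α₀ → 0 < α₁ → α₀ + α₁ ≤ cP →
      ∀ U₀ U' : Site d → Fin d → 𝔸ˣ, (∀ x κ, U₀ x κ ∈ unitaryUnits 𝔸) → (∀ x κ, U' x κ ∈ unitaryUnits 𝔸) →
      IsPeriodic P U₀ → IsPeriodic P U' → ∀ φ : Φ, Adm φ U₀ α₀ α₁ →
      InAk L k η α₀ Ω U₀ → InAk L k η α₀ Ω (mulCfg U' U₀) → (∀ m, m ≤ k → InAx L m (Λs m) U₀ (mulCfg U' U₀)) →
      (∀ j, j ≤ k → ∀ (z : Site d) (μ : Fin d),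
        ((∀ x, InBox (tlo L z j) (thi L z j) x → x ∈ Ω j) ∨ (∀ x, InBox (tlo L (z + e μ) j) (thi L (z + e μ) j) x → x ∈ Ω j)) →
        ‖(avgIter L (mulCfg U' U₀) j z μ : 𝔸) - (avgIter L U₀ j z μ : 𝔸)‖ ≤ α₁) →
      (∀ b ∈ {b : Site d × Fin d | SideTouches (Ω 0) b.1 b.2}, ‖((U' b.1 b.2 : 𝔸ˣ) : 𝔸) - 1‖ ≤ α₁) →
      (∀ m, 1 ≤ m → m ≤ k → ∀ (u : Site d → 𝔸ˣ) (W : Site d → Fin d → 𝔸ˣ) (A' : Site d → Fin d → 𝔸),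
        (∀ x, u x ∈ unitaryUnits 𝔸) → IsPeriodic P u → IsPeriodic P W → IsPeriodic P A' →
        mgauge U₀ u W = U' → Restr129 L m (Λs m) U₀ u → LanF U₀ φ m W →
        (∀ y τ, IsSelfAdjoint (A' y τ)) →
        (∀ j, j ≤ m → ∀ y τ, SideTouches (Ω j) y τ →
        W y τ = cfgExp η A' y τ ∧ ‖A' y τ‖ ≤ (2 * (L * (5 * (d : ℝ) * L * B₈ * (α₀ + α₁))) + 8 * (8 * B₀' * (5 * (d : ℝ) * L * B₈) * (α₀ + α₁))) * ((L : ℝ) ^ j * η)⁻¹) →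
        (∀ y τ, (∀ j, j ≤ m → ¬ SideTouches (Ω j) y τ) → A' y τ = 0) →
        msup L m η (-(1 : ℝ)) (fun j (b : Site d × Fin d) => SideTouches (Ω j) b.1 b.2) (fun b => A' b.1 b.2)
        ≤ B₀ * (bondNorm L m η (-(3 : ℝ)) Ω (fun x μ => Jcur η U₀ A' μ x)
        + wsup 1 (fun p : {p : ℕ × (Site d × Fin d) // p.1 ≤ m ∧ p.2 ∈ Λb m p.1} =>
        linCovIter L U₀ (iEta η A') p.1.1 p.1.2.1 p.1.2.2)) + γ' * B₀ * (α₀ + α₁) ∧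
        msup L m η (-(2 : ℝ)) (fun j (t : Fin d × Fin d × Site d) => SideTouches (Ω j) t.2.2 t.2.1)
        (fun t => covDerivFwd η U₀ t.1 (fun z => A' z t.2.1) t.2.2)
        ≤ B₀ * (bondNorm L m η (-(3 : ℝ)) Ω (fun x μ => Jcur η U₀ A' μ x)
        + wsup 1 (fun p : {p : ℕ × (Site d × Fin d) // p.1 ≤ m ∧ p.2 ∈ Λb m p.1} =>
        linCovIter L U₀ (iEta η A') p.1.1 p.1.2.1 p.1.2.2)) + γ' * B₀ * (α₀ + α₁)))
    -- (c) the windows family below `c_P` (the consequent of `B8SockWindowsSrc.uniqWindows_of_guard_src` at source size `γ`; `c_{DA} = 2dL²c⋆₈`)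
    (hwin : ∀ α₀ α₁ : ℝ, 0 < α₀ → 0 < α₁ → α₀ + α₁ ≤ cP →
      ∀ cs cB cDA hE hE₂ lE lE₂ : ℝ, cs = 5 * (d : ℝ) * L * B₈ * (α₀ + α₁) → cB = L * cs → cDA = 2 * (d : ℝ) * (L : ℝ) ^ 2 * cs →
      hE = B₀'H * (C2p d * (40 * d * cB + α₄) * α₄) → hE₂ = B₂' * (C2p d * (40 * d * cB + α₄) * α₄) →
      lE = B₀'H * (4 * C2p d * (40 * d * cB + 2 * α₄)) → lE₂ = B₂' * (4 * C2p d * (40 * d * cB + 2 * α₄)) →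
      36 * d * B₈ * cs ≤ 1 / 2 ∧
      8 * (131072 * ((d : ℝ) + 1) ^ 2) * Real.exp (4 * (800 * ((d : ℝ) + 1) ^ 2 * ((d : ℝ) + 4)) * α₀) ≤ 16 * (131072 * ((d : ℝ) + 1) ^ 2) ∧
      2 * cs ^ 2 + 20 * d * α₀ * cs + 2 * (16 * (131072 * ((d : ℝ) + 1) ^ 2)) * cs ^ 2 ≤ α₀ + α₁ ∧
      (d : ℝ) * L * α₁ ≤ 1 / 8 ∧
      C0 d * α₀ ≤ 1 / 3 ∧ 4 * α₀ ≤ c2' d L ∧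
      Real.exp (4 * (800 * ((d : ℝ) + 1) ^ 2 * ((d : ℝ) + 4)) * α₀) * (1 + 8 * (131072 * ((d : ℝ) + 1) ^ 2) * cB) ≤ 2 ∧
      2 * cB ≤ c3 d L ∧ 2048 * (d : ℝ) * cB ≤ 1 ∧ 40 * d * cB ≤ 1 / 200 ∧
      200 * C6 d * (2 * α₄) ≤ 1 ∧ 12000 * ((d : ℝ) + 1) * L * (2 * α₄) ≤ 1 ∧
      C4G d L * (α₀ + 40 * d * cB + 4 * (2 * α₄)) ≤ 1 ∧
      1024 * ((d : ℝ) + 1) * ((d : ℝ) + 4) * L ^ 2 * α₀ ≤ 1 ∧ 32 * ((d : ℝ) + 1) ^ 2 * C6 d * L ^ 2 * α₀ ≤ 1 ∧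
      16 * d * C5' d * C6 d * (L : ℝ) ^ 2 * α₀ ≤ 1 ∧ 8 * d * C6 d * L * α₀ ≤ 1 ∧
      40 * d * cB + α₄ ≤ 1 / (4 * B₀'H * (2 * C2p d)) ∧ 2 * C6 d * (40 * d * cB + 4 * α₄) ≤ 1 / 8 ∧
      cB ≤ 1 / 13 ∧ α₄ / 4 + hE ≤ 1 / 24 ∧ α₄ / 4 + hE ≤ 1 / 140 ∧ 10 * (α₄ / 4 + hE) * BR ≤ 1 / 2 ∧
      BG * Mc d BR (α₄ / 4 + hE) cB (hE₂ + γ * (α₀ + α₁) / 2) cDA ≤ α₄ / 4 ∧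
      BG * Kc d BR (α₄ / 4 + hE) cB (hE₂ + γ * (α₀ + α₁) / 2) cDA lE₂ (1 + lE) (1 + lE) ≤ 1 / 2 ∧
      lE ≤ 1 / 2 ∧ cu + hE ≤ α₄ / 4)
    -- (d) EDITION γ: the γ windows family below `c_P` (`B8SockP5uEProviderGamma.gammaWindows_of_guard` at `B₈`)
    (hwinγ : ∀ α₀ α₁ : ℝ, 0 < α₀ → 0 < α₁ → α₀ + α₁ ≤ cP →
      ∀ cs cB : ℝ, cs = 5 * (d : ℝ) * L * B₈ * (α₀ + α₁) → cB = L * cs →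
      C0 d * ((L : ℝ) ^ 2 * α₀) ≤ 1 / 3 ∧ 4 * ((L : ℝ) ^ 2 * α₀) ≤ c2' d L ∧
      Real.exp (4 * (800 * ((d : ℝ) + 1) ^ 2 * ((d : ℝ) + 4)) * ((L : ℝ) ^ 2 * α₀)) * (1 + 8 * (131072 * ((d : ℝ) + 1) ^ 2) * cB) ≤ 2 ∧
      8 * (131072 * ((d : ℝ) + 1) ^ 2) * Real.exp (4 * (800 * ((d : ℝ) + 1) ^ 2 * ((d : ℝ) + 4)) * ((L : ℝ) ^ 2 * α₀)) * (L : ℝ) ^ 2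
        ≤ 16 * (131072 * ((d : ℝ) + 1) ^ 2) * (L : ℝ) ^ 2 ∧
      2 * cs ^ 2 + 20 * d * α₀ * cs + 2 * (16 * (131072 * ((d : ℝ) + 1) ^ 2) * (L : ℝ) ^ 2) * cs ^ 2 ≤ α₀ + α₁) :
    -- THE `SP5u` BINDER TEXT OF T5 AT THIS MEMBER (`ι a ↦ (η, k, Ω, Λs)`, `p a ↦ P`, `Adm a ↦ Adm`, `LanF a ↦ LanF`) — identical to instance (i)'s
    ∀ α₀ α₁ : ℝ, 0 < α₀ → 0 < α₁ → α₀ + α₁ ≤ cP →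
      ∀ U₀ U' : Site d → Fin d → 𝔸ˣ, (∀ x κ, U₀ x κ ∈ unitaryUnits 𝔸) → (∀ x κ, U' x κ ∈ unitaryUnits 𝔸) →
      IsPeriodic P U₀ → IsPeriodic P U' → ∀ φ : Φ, Adm φ U₀ α₀ α₁ →
      InAk L k η α₀ Ω U₀ → InAk L k η α₀ Ω (mulCfg U' U₀) → (∀ m, m ≤ k → InAx L m (Λs m) U₀ (mulCfg U' U₀)) →
      (∀ j, j ≤ k → ∀ (z : Site d) (μ : Fin d),
        ((∀ x, InBox (tlo L z j) (thi L z j) x → x ∈ Ω j) ∨ (∀ x, InBox (tlo L (z + e μ) j) (thi L (z + e μ) j) x → x ∈ Ω j)) →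
        ‖(avgIter L (mulCfg U' U₀) j z μ : 𝔸) - (avgIter L U₀ j z μ : 𝔸)‖ ≤ α₁) →
      (∀ b ∈ {b : Site d × Fin d | SideTouches (Ω 0) b.1 b.2}, ‖((U' b.1 b.2 : 𝔸ˣ) : 𝔸) - 1‖ ≤ α₁) →
      ∀ u₁ : Site d → 𝔸ˣ, (∀ x, u₁ x ∈ unitaryUnits 𝔸) → (∀ x, x ∉ Ω 0 → u₁ x = 1) → IsPeriodic P u₁ → Restr129 L k (Λs k) U₀ u₁ →
      LanF U₀ φ k (mgauge U₀ u₁⁻¹ U') →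
      (∃ A₁ : Site d → Fin d → 𝔸, ∀ j, j ≤ k → ∀ (x : Site d) (κ : Fin d), SideTouches (Ω j) x κ →
        mgauge U₀ u₁⁻¹ U' x κ = cfgExp η A₁ x κ ∧ ‖A₁ x κ‖ ≤ (5 * (d : ℝ) * L * B₈ * (α₀ + α₁)) * ((L : ℝ) ^ j * η)⁻¹) →
      ∀ (v w : Site d → 𝔸ˣ) (lam mu : Site d → 𝔸),
      IsPeriodic P v → IsPeriodic P w → IsPeriodic P lam → IsPeriodic P mu →
      (∀ x, ((gaugeExp lam x : 𝔸ˣ) : 𝔸) = ((v x : 𝔸ˣ) : 𝔸) ∧ IsSelfAdjoint (lam x) ∧ ‖lam x‖ < cu) → (∀ x, x ∉ Ω 0 → lam x = 0) →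
      (∀ j, j ≤ k → ∀ b ∈ {b : Site d × Fin d | SideTouches (Ω j) b.1 b.2}, ((L : ℝ) ^ j * η) * ‖covDerivFwd η U₀ b.2 lam b.1‖ < cu) →
      (∀ x, ((gaugeExp mu x : 𝔸ˣ) : 𝔸) = ((w x : 𝔸ˣ) : 𝔸) ∧ IsSelfAdjoint (mu x) ∧ ‖mu x‖ < cu) → (∀ x, x ∉ Ω 0 → mu x = 0) →
      (∀ j, j ≤ k → ∀ b ∈ {b : Site d × Fin d | SideTouches (Ω j) b.1 b.2}, ((L : ℝ) ^ j * η) * ‖covDerivFwd η U₀ b.2 mu b.1‖ < cu) →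
      LanF U₀ φ k (mgauge U₀ v⁻¹ (mgauge U₀ u₁⁻¹ U')) → Restr129 L k (Λs k) U₀ (u₁ * v) →
      LanF U₀ φ k (mgauge U₀ w⁻¹ (mgauge U₀ u₁⁻¹ U')) → Restr129 L k (Λs k) U₀ (u₁ * w) →
      ∀ x, v x = w x := by
  intro α₀ α₁ hα₀ hα₁ hs U₀ U' hU₀ hU' hU₀per hU'per φ hφ h33 h34 hAx h135 h66 u₁ hu₁ _ hu₁per h129 hLan hdat v w lam mu _ _ hlP hmP hv _ hvD
    hw _ hwD hLv hRv hLw hRw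
  have hL1 : 1 ≤ L := le_trans (by norm_num) hL
  have hLr : (1 : ℝ) ≤ L := by exact_mod_cast hL1
  have hsum : 0 < α₀ + α₁ := add_pos hα₀ hα₁
  have hB₈ : 0 < B₈ := lt_of_lt_of_le hB₀ hB₀8
  -- the windows at this (α₀, α₁)
  obtain ⟨hside, -, -, hsmall₁, hα3, hα4, hsmall, hc₃, hsc, hα₃', hs₁, hs₂, hs₃, hs₄, hs₅, hs₆, hs₇, hsm, hprod8, hcA', ha₁',
    hb₁', hθ, h103, h106, hlE, hcu⟩ := hwin α₀ α₁ hα₀ hα₁ hs _ _ _ _ _ _ _ rfl rfl rfl rfl rfl rfl rfl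
  -- the γ windows at this (α₀, α₁) (the (1.56)-constant line and (1.61) are the γ ones)
  obtain ⟨hα3L, hα4L, hsmallL, hC₂L, h61L⟩ := hwinγ α₀ α₁ hα₀ hα₁ hs _ _ rfl rfl
  -- the letters at the top structure, at the PERIODIC background `U₀`
  have hα₀L : α₀ ≤ cL := by linarith only [hs, hcPL, hα₁]
  obtain ⟨g, Δ, q, qs, Aw, c, H', g_leftB, c_left', hΔ, hqs, hq, hq0, hGper, hAw_per, hH0, hH1, hH2, hHper, hQH, hG, hRbd⟩ :=
    SLetUBper α₀ hα₀ hα₀L U₀ hU₀ hU₀per h33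
  have hcs0 : 0 ≤ 5 * (d : ℝ) * L * B₈ * (α₀ + α₁) := by positivity
  -- THE SOURCE `src φ` of this admitted `φ`: size `γ(α₀ + α₁)` on the `Ω_j`, `j ≤ k` (from the `Bdd` clause and the norm premiss), and `P`-periodic
  obtain ⟨⟨hBdd, hφn⟩, hfP⟩ := hAdm φ U₀ α₀ α₁ hφ
  have hmf : 0 ≤ γ * (α₀ + α₁) := by positivity
  have hf : Bd2 L η k Ω (src φ) (γ * (α₀ + α₁)) := by
    intro j hj x hx
    have h := weight_mul_norm_le_msup hBdd hj (i := x) hx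
    have e2 : (-(2 : ℝ)) = -((2 : ℕ) : ℝ) := by norm_num
    rw [e2, weight_neg_natCast L η 2 j] at h
    have hw : wt L η j ^ 2 = ((L : ℝ) ^ j * η) ^ 2 := rfl
    rw [hw]
    rw [e2] at hφn
    exact h.trans hφn.le
  -- the datum `U₁ = U′^{u₁⁻¹}`: `U′ = U₁^{u₁}`, and `U₁` is `P`-periodic (the guard of `SH59`)
  have hW : mgauge U₀ u₁ (mgauge U₀ u₁⁻¹ U') = U' := mgauge_mgauge_inv U₀ U' u₁
  have hWP : IsPeriodic P (mgauge U₀ u₁⁻¹ U') := fun x m => funext fun κ =>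
    mgauge_periodic (p := (P : ℤ) • m) (fun y κ => by rw [hU₀per y m]) (fun y κ => by rw [hU'per y m])
      (fun y => by rw [Pi.inv_apply, Pi.inv_apply, hu₁per y m]) x κ
  -- the SOURCED b9 lines at the datum, top level `k`, for every PERIODIC masked exponent, from `SH59` at `m = k` (monotonicity `B₀ ≤ B₈` on the
  -- non-negative bracket; the datum bound `c⋆₈` ≤ the socket's constant)
  have hSg : 0 ≤ γ' * B₀ * (α₀ + α₁) := by positivity
  have SH59k : ∀ A' : Site d → Fin d → 𝔸, (∀ x m : Site d, A' (x + (P : ℤ) • m) = A' x) → (∀ y τ, IsSelfAdjoint (A' y τ)) →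
      (∀ j, j ≤ k → ∀ (y : Site d) (τ : Fin d), SideTouches (Ω j) y τ →
        mgauge U₀ u₁⁻¹ U' y τ = cfgExp η A' y τ ∧ ‖A' y τ‖ ≤ (5 * (d : ℝ) * L * B₈ * (α₀ + α₁)) * ((L : ℝ) ^ j * η)⁻¹) →
      (∀ (y : Site d) (τ : Fin d), (∀ j, j ≤ k → ¬ SideTouches (Ω j) y τ) → A' y τ = 0) →
      msup L k η (-(1 : ℝ)) (fun j (b : Site d × Fin d) => SideTouches (Ω j) b.1 b.2) (fun b => A' b.1 b.2)
          ≤ B₈ * (bondNorm L k η (-(3 : ℝ)) Ω (fun x μ => Jcur η U₀ A' μ x)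
          + wsup 1 (fun p : {p : ℕ × (Site d × Fin d) // p.1 ≤ k ∧ p.2 ∈ Λb k p.1} =>
          linCovIter L U₀ (iEta η A') p.1.1 p.1.2.1 p.1.2.2)) + γ' * B₀ * (α₀ + α₁) ∧
        msup L k η (-(2 : ℝ)) (fun j (t : Fin d × Fin d × Site d) => SideTouches (Ω j) t.2.2 t.2.1)
          (fun t => covDerivFwd η U₀ t.1 (fun z => A' z t.2.1) t.2.2)
          ≤ B₈ * (bondNorm L k η (-(3 : ℝ)) Ω (fun x μ => Jcur η U₀ A' μ x)
          + wsup 1 (fun p : {p : ℕ × (Site d × Fin d) // p.1 ≤ k ∧ p.2 ∈ Λb k p.1} =>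
          linCovIter L U₀ (iEta η A') p.1.1 p.1.2.1 p.1.2.2)) + γ' * B₀ * (α₀ + α₁) := by
    intro A' hA'P hsa' hWA' hA0'
    have hbig : ∀ j, j ≤ k → ∀ (y : Site d) (τ : Fin d), SideTouches (Ω j) y τ →
        mgauge U₀ u₁⁻¹ U' y τ = cfgExp η A' y τ ∧ ‖A' y τ‖ ≤ (2 * (L * (5 * (d : ℝ) * L * B₈ * (α₀ + α₁))) +
          8 * (8 * B₀' * (5 * (d : ℝ) * L * B₈) * (α₀ + α₁))) * ((L : ℝ) ^ j * η)⁻¹ := by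
      intro j hj y τ hsd
      obtain ⟨he, hb⟩ := hWA' j hj y τ hsd
      refine ⟨he, hb.trans (mul_le_mul_of_nonneg_right ?_ (by positivity))⟩
      have h1 : (1 : ℝ) * (5 * (d : ℝ) * L * B₈ * (α₀ + α₁)) ≤ L * (5 * (d : ℝ) * L * B₈ * (α₀ + α₁)) :=
        mul_le_mul_of_nonneg_right hLr hcs0
      have h2 : 0 ≤ 8 * (8 * B₀' * (5 * (d : ℝ) * L * B₈) * (α₀ + α₁)) := by positivity
      linarith only [h1, h2, hcs0]
    obtain ⟨h1, h2⟩ := SH59 α₀ α₁ hα₀ hα₁ hs U₀ U' hU₀ hU' hU₀per hU'per φ hφ h33 h34 hAx h135 h66 k hk le_rfl u₁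
      (mgauge U₀ u₁⁻¹ U') A' hu₁ hu₁per hWP hA'P hW h129 hLan hsa' hbig hA0'
    have hX : 0 ≤ bondNorm L k η (-(3 : ℝ)) Ω (fun x μ => Jcur η U₀ A' μ x)
        + wsup 1 (fun p : {p : ℕ × (Site d × Fin d) // p.1 ≤ k ∧ p.2 ∈ Λb k p.1} =>
          linCovIter L U₀ (iEta η A') p.1.1 p.1.2.1 p.1.2.2) := by
      have ha : 0 ≤ bondNorm L k η (-(3 : ℝ)) Ω (fun x μ => Jcur η U₀ A' μ x) := by
        unfold bondNorm; exact msup_nonneg L k hη.le _ _ _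
      have hb := wsup_nonneg zero_le_one (fun p : {p : ℕ × (Site d × Fin d) // p.1 ≤ k ∧ p.2 ∈ Λb k p.1} =>
        linCovIter L U₀ (iEta η A') p.1.1 p.1.2.1 p.1.2.2)
      linarith only [ha, hb]
    have hmono := mul_le_mul_of_nonneg_right hB₀8 hX
    exact ⟨h1.trans (by linarith only [hmono]), h2.trans (by linarith only [hmono])⟩
  -- `c_{DA} = 2dL²c⋆₈ ≥ dL²(c⋆₈ + 2Sg)` since `2γ′B₀ ≤ 5dLB₈`
  have hcDAlo : (d : ℝ) * (L : ℝ) ^ 2 * (5 * (d : ℝ) * L * B₈ * (α₀ + α₁) + 2 * (γ' * B₀ * (α₀ + α₁))) ≤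
      2 * (d : ℝ) * (L : ℝ) ^ 2 * (5 * (d : ℝ) * L * B₈ * (α₀ + α₁)) := by
    have hγB' : 2 * (γ' * B₀) ≤ 5 * (d : ℝ) * L * B₈ := by
      have h0 : 0 ≤ 5 * (d : ℝ) * L * B₀ := by positivity
      linarith only [hγB, h0]
    have h1 : 2 * (γ' * B₀ * (α₀ + α₁)) ≤ 5 * (d : ℝ) * L * B₈ * (α₀ + α₁) := by
      have h := mul_le_mul_of_nonneg_right hγB' hsum.le
      linarith only [h]
    have h2 : (0 : ℝ) ≤ (d : ℝ) * (L : ℝ) ^ 2 := by positivity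
    have h3 := mul_le_mul_of_nonneg_left h1 h2
    linarith only [h3]
  -- the torus data of U1: every `Lʲ ∣ P`, `j ≤ k`
  have hdivP : ∀ j, j ≤ k → ((L : ℤ) ^ j ∣ (P : ℤ)) := fun j hj => (pow_dvd_pow (L : ℤ) hj).trans hPdiv
  -- U1″ (`sockP5uE_body_src_γ'_per`) at `B₀ := B₈`, `Lan := LanF U₀ φ`, `Sa = Sg := γ′B₀(α₀ + α₁)`, `f := src φ`, `m_f := γ(α₀ + α₁)`; the competitors'
  -- conditions at the top level are the multiplier form of (1.146) by `hLan146`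
  exact sockP5uE_body_src_γ'_per hd2 hL hη hk (P : ℤ) hΩ hΩ0 hbox hclass htower hdivP hΛ hα₀ hα₁ hB₈ rfl hα₄ hU₀ hU' hU₀per hU'per h33 h34 hAx h135
    hu₁ hu₁per h129 (fun n W => LanF U₀ φ n W) hLan hdat hSg SH59k hmf hf hfP hside hC₂L h61L hsmall₁ g Δ q qs Aw c g_leftB c_left' hΔ hqs hq hq0
    hGper hAw_per H' hB₀'H hB₂' hBG hBR hH0 hH1 hH2 hHper hQH hG hRbd le_rfl le_rfl hcDAlo hα3 hα4 hα3L hα4L hsmallL hsmall hc₃ hsc hα₃' hs₁ hs₂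
    hs₃ hs₄ hs₅ hs₆ hs₇ hsm hprod8 rfl rfl rfl rfl hcA' ha₁' hb₁' hθ h103 h106 hlE hcu hlP hmP hv hvD hw hwD (hLan146 _ _ _ hLv) hRv
    (hLan146 _ _ _ hLw) hRw

end Provider

/-! ## §2 (U3″) The member-indexed server below one member-uniform pair of thresholds — T5's `SP5u` text at `(i, P)` verbatim, Theorem 8's source -/

section Server

variable {L : ℕ} {B₀ B₀' B₈ B₀'H B₂' BG BR cL γ γ' c59 : ℝ}

/-- ★★★ **THE N05 KNIT's UNIQUENESS SOCKET `SP5u` SERVED AT NESTED PERIODIC MEMBERS, THEOREM 8's SOURCE, BELOW ONE MEMBER-UNIFORM PAIR OF THRESHOLDS**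
(Prop. 5 p. 94: «There exist positive constants c₂, c₃, depending on d and L only … Such a configuration u′ is unique in the domain |λ|, |Dλ|₍₋₁₎ < c₃»
(1.109); Thm 4 p. 95; Thm 8 p. 101 «exactly one gauge transformation u»; on the torus §3 p. 98): `∃ cu cP > 0` FIRST — functions of
`(d, L, B₈, B₀′ᴴ, B₂′, B_G, B_R, γ, c_L, c₅₉)` only (`cu` := the radius of `B8SockWindowsSrc.uniqWindows_of_guard_src` at source size `γ`,
`cP := min(c_W, c_L, c₅₉, c_γ)` with `c_γ(d, L, B₈)` of `gammaWindows_of_guard`) — THEN at every member `i : ZdIdx d L` and period `P : ℕ`, for every `Φ`, `Adm`,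
`LanF` and source map `src : Φ → (Site d → 𝔸)` such that admissibility hands the source's size `< γ(α₀ + α₁)` in the `(−2)`-weighted sup norm on the `i.Ω j`
(with its `Bdd` certificate) and its `P`-periodicity, and the top-level gauge condition implies THE MULTIPLIER FORM OF (1.146) with source `src φ`
(`LanF U₀ φ i.k W → ∃ μ, Δ↾Ω₀[D*((iη)⁻¹ log W) − src φ] = Q′ᵀμ`; instance (ii): `Φ := Site d → 𝔸`, `src := id`, projections of the knit's `Adm` and
`IsLandau146W`'s second clause), under the three laws of the periodic (1.5)-index (`i.Ω 0 = univ`; `Lᵏ ∣ P`; `i.Λs i.k j` invariant under the period shifts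
`+ (P∕Lʲ) • e ι`, `j ≤ k`), the supplier `SLetUBper` of [4]'s uniqueness letters at `(i, P)` (laws at periodic arguments, regime `α₀ ≤ c_L`) and T5's own
guarded sourced b9 socket text `SH59src` at `(i, P)` below `c₅₉` (class `towerBondsP L i.Ω (i.Λs m) ·`): **T5's `SP5u` binder text
(`B8Thm4CoreZdGF3HP2PerLanEGamma.thm4Core_zdGF3HP₂Per_map_lanE_γ'` :174–:194) at `(i, P)` VERBATIM.**  Proof: U2″ `sp5u_of_lettersUB_src_γ'_per` at the member's
own tower (`B8TowerBondsPrinted.ZdIdx.towerBondsP_laws i`), the windows discharged by `uniqWindows_of_guard_src` (source size `γ`) and `gammaWindows_of_guard`.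
[cite: Balaban1985RegularSpaces, Prop. 5 (1.109) p.94 («c₂, c₃»), Thm 4 p.88 («exactly one»), p.95, Thm 8 (1.146) p.101, (1.5)–(1.6) p.77, (1.31) p.82, §3 p.98; Balaban1985Averaging, (4) p.18; Balaban1985BackgroundPropagators, Thm 3.1 p.397, Thm 3.3 p.398] -/
theorem sockP5uSrcPer_of_lettersAtPerNested (hd2 : 2 ≤ d) (hL : 2 ≤ L) (hB : 2 ≤ 5 * (d : ℝ) * L * B₈) (hcL : 0 < cL) (hB₀ : 0 < B₀) (hB₀' : 0 < B₀')
    (hB₀'H : 0 < B₀'H) (hB₂' : 0 ≤ B₂') (hBG : 0 ≤ BG) (hBR : 0 ≤ BR) (hγ : 0 ≤ γ) (hγ' : 0 ≤ γ') (hB₀8 : B₀ ≤ B₈)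
    (hγB : 5 * (d : ℝ) * L * B₀ + 2 * (γ' * B₀) ≤ 5 * (d : ℝ) * L * B₈) (hc59 : 0 < c59) :
    ∃ cu cP : ℝ, 0 < cu ∧ 0 < cP ∧
      ∀ (i : ZdIdx d L) (P : ℕ) {Φ : Type*} (Adm : Φ → (Site d → Fin d → 𝔸ˣ) → ℝ → ℝ → Prop)
        (LanF : (Site d → Fin d → 𝔸ˣ) → Φ → ℕ → (Site d → Fin d → 𝔸ˣ) → Prop) (src : Φ → Site d → 𝔸),
      -- the knit's admissibility hands the source's size `< γ(α₀ + α₁)` in the `(−2)`-weighted sup norm on the `i.Ω j` (with its `Bdd` certificate) and its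
      -- `P`-periodicity; the knit's gauge predicate implies THE MULTIPLIER FORM OF (1.146) with source `src φ` at the top level (instance (ii): projections of
      -- the knit's `Adm`; `IsLandau146W`'s second clause)
      (∀ (φ : Φ) (U₀ : Site d → Fin d → 𝔸ˣ) (α₀ α₁ : ℝ), Adm φ U₀ α₀ α₁ →
        (Bdd L i.k i.η (-(2 : ℝ)) (fun j (x : Site d) => x ∈ i.Ω j) (src φ) ∧
          msup L i.k i.η (-(2 : ℝ)) (fun j (x : Site d) => x ∈ i.Ω j) (src φ) < γ * (α₀ + α₁)) ∧ IsPeriodic P (src φ)) →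
      (∀ (U₀ : Site d → Fin d → 𝔸ˣ) (φ : Φ) (W : Site d → Fin d → 𝔸ˣ), LanF U₀ φ i.k W →
        ∃ μ : ℕ → Site d → 𝔸, ∀ x ∈ i.Ω 0,
          covLap i.η U₀ ((i.Ω 0).indicator (covDivB i.η U₀ (logCfg i.η W) - src φ)) x = QT L i.k (i.Λs i.k) U₀ μ x) →
      -- the three laws of the periodic (1.5)-index at this member (p. 77 «Ω_j ⊂ T_η», (1.5)–(1.6))
      i.Ω 0 = Set.univ → ((L : ℤ) ^ i.k ∣ (P : ℤ)) →
      (∀ j, j ≤ i.k → ∀ (y : Site d) (ι : Fin d), y + ((P : ℤ) / (L : ℤ) ^ j) • e ι ∈ i.Λs i.k j ↔ y ∈ i.Λs i.k j) →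
      -- (a) ONE SUPPLIER of [4]'s uniqueness letters at `(i.k, i.Λs i.k, U₀)` for unitary `P`-PERIODIC backgrounds in the regime `α₀ ≤ c_L`
      (∀ α₀ : ℝ, 0 < α₀ → α₀ ≤ cL → ∀ U₀ : Site d → Fin d → 𝔸ˣ, (∀ x κ, U₀ x κ ∈ unitaryUnits 𝔸) → IsPeriodic P U₀ → InAk L i.k i.η α₀ i.Ω U₀ →
        ∃ (g Δ : (Site d → 𝔸) →ₗ[ℂ] (Site d → 𝔸)) (q : (Site d → 𝔸) →ₗ[ℂ] (ℕ → Site d → 𝔸)) (qs : (ℕ → Site d → 𝔸) →ₗ[ℂ] (Site d → 𝔸))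
          (Aw c : (ℕ → Site d → 𝔸) →ₗ[ℂ] (ℕ → Site d → 𝔸)) (H' : XSpace d i.k 𝔸 →ₗ[ℂ] (Site d → 𝔸)),
          (∀ x : Site d → 𝔸, (∀ (z : Site d) (ι : Fin d), x (z + (P : ℤ) • e ι) = x z) → (∃ C : ℝ, ∀ y, ‖x y‖ ≤ C) →
            g (Δ x + qs (Aw (q x))) = x) ∧
          (∀ φ : ℕ → Site d → 𝔸, (∀ j, j ≤ i.k → ∀ (y : Site d) (ι : Fin d), φ j (y + ((P : ℤ) / (L : ℤ) ^ j) • e ι) = φ j y) →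
            qs (c (q (g (g (qs φ))))) = qs φ) ∧
          (∀ (f : Site d → 𝔸), ∀ x ∈ i.Ω 0, Δ f x = covLap i.η U₀ ((i.Ω 0).indicator f) x) ∧
          (∀ (μ : ℕ → Site d → 𝔸), ∀ x ∈ i.Ω 0, qs μ x = QT L i.k (i.Λs i.k) U₀ μ x) ∧
          (∀ (f : Site d → 𝔸) (j : ℕ), j ≤ i.k → ∀ y ∈ i.Λs i.k j, q f j y = QprimeIter (zdBlocking d L) (bgT L U₀) j f y) ∧
          (∀ (f : Site d → 𝔸) (j : ℕ) (y : Site d), ¬ (j ≤ i.k ∧ y ∈ i.Λs i.k j) → q f j y = 0) ∧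
          (∀ (f : Site d → 𝔸) (z : Site d) (ι : Fin d), g f (z + (P : ℤ) • e ι) = g f z) ∧
          (∀ μ : ℕ → Site d → 𝔸, ∀ j, j ≤ i.k → ∀ (y : Site d) (ι : Fin d), Aw μ j (y + ((P : ℤ) / (L : ℤ) ^ j) • e ι) = Aw μ j y) ∧
          (∀ (X : XSpace d i.k 𝔸) (x : Site d), ‖H' X x‖ ≤ B₀'H * ‖X‖) ∧
          (∀ j, j ≤ i.k → ∀ (X : XSpace d i.k 𝔸), ∀ p ∈ {b : Site d × Fin d | SideTouches (i.Ω j) b.1 b.2},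
            wt L i.η j * ‖covDerivFwd i.η U₀ p.2 (H' X) p.1‖ ≤ B₀'H * ‖X‖) ∧
          (∀ X : XSpace d i.k 𝔸, Bd2 L i.η i.k i.Ω (covLap i.η U₀ (H' X)) (B₂' * ‖X‖)) ∧
          (∀ X : XSpace d i.k 𝔸, (∀ (p : Fin (i.k + 1) × Site d) (ι : Fin d), X (p.1, p.2 + ((P : ℤ) / (L : ℤ) ^ (p.1 : ℕ)) • e ι) = X p) →
            ∀ (z : Site d) (ι : Fin d), H' X (z + (P : ℤ) • e ι) = H' X z) ∧
          (∀ (Y : XSpace d i.k 𝔸), (∀ (p : Fin (i.k + 1) × Site d) (ι : Fin d), Y (p.1, p.2 + ((P : ℤ) / (L : ℤ) ^ (p.1 : ℕ)) • e ι) = Y p) →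
            ∀ (j : ℕ) (hj : j ≤ i.k) (y : Site d), y ∈ i.Λs i.k j →
            QprimeIter (zdBlocking d L) (bgT L U₀) j (H' Y) y = Y (⟨j, Nat.lt_succ_of_le hj⟩, y)) ∧
          (∀ (f : Site d → 𝔸) (r : ℝ), 0 ≤ r → Bd2 L i.η i.k i.Ω f r →
            (∀ x, ‖g f x‖ ≤ BG * r) ∧ ∀ j, j ≤ i.k → ∀ p ∈ {b : Site d × Fin d | SideTouches (i.Ω j) b.1 b.2},
              wt L i.η j * ‖covDerivFwd i.η U₀ p.2 (g f) p.1‖ ≤ BG * r) ∧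
          (∀ (f : Site d → 𝔸) (r : ℝ), 0 ≤ r → Bd2 L i.η i.k i.Ω f r → Bd2 L i.η i.k i.Ω (f - g (qs (c (q (g f))))) (BR * r))) →
      -- (b) T5's OWN guarded sourced b9 socket text `SH59src` at `(i, P)` below `c₅₉`
      (∀ α₀ α₁ : ℝ, 0 < α₀ → 0 < α₁ → α₀ + α₁ ≤ c59 →
        ∀ U₀ U' : Site d → Fin d → 𝔸ˣ, (∀ x κ, U₀ x κ ∈ unitaryUnits 𝔸) → (∀ x κ, U' x κ ∈ unitaryUnits 𝔸) →
        IsPeriodic P U₀ → IsPeriodic P U' → ∀ φ : Φ, Adm φ U₀ α₀ α₁ →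
        InAk L i.k i.η α₀ i.Ω U₀ → InAk L i.k i.η α₀ i.Ω (mulCfg U' U₀) → (∀ m, m ≤ i.k → InAx L m (i.Λs m) U₀ (mulCfg U' U₀)) →
        (∀ j, j ≤ i.k → ∀ (z : Site d) (μ : Fin d),
          ((∀ x, InBox (tlo L z j) (thi L z j) x → x ∈ i.Ω j) ∨ (∀ x, InBox (tlo L (z + e μ) j) (thi L (z + e μ) j) x → x ∈ i.Ω j)) →
          ‖(avgIter L (mulCfg U' U₀) j z μ : 𝔸) - (avgIter L U₀ j z μ : 𝔸)‖ ≤ α₁) →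
        (∀ b ∈ {b : Site d × Fin d | SideTouches (i.Ω 0) b.1 b.2}, ‖((U' b.1 b.2 : 𝔸ˣ) : 𝔸) - 1‖ ≤ α₁) →
        (∀ m, 1 ≤ m → m ≤ i.k → ∀ (u : Site d → 𝔸ˣ) (W : Site d → Fin d → 𝔸ˣ) (A' : Site d → Fin d → 𝔸),
          (∀ x, u x ∈ unitaryUnits 𝔸) → IsPeriodic P u → IsPeriodic P W → IsPeriodic P A' →
          mgauge U₀ u W = U' → Restr129 L m (i.Λs m) U₀ u → LanF U₀ φ m W →
          (∀ y τ, IsSelfAdjoint (A' y τ)) →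
          (∀ j, j ≤ m → ∀ y τ, SideTouches (i.Ω j) y τ →
          W y τ = cfgExp i.η A' y τ ∧ ‖A' y τ‖ ≤ (2 * (L * (5 * (d : ℝ) * L * B₈ * (α₀ + α₁))) + 8 * (8 * B₀' * (5 * (d : ℝ) * L * B₈) * (α₀ + α₁))) * ((L : ℝ) ^ j * i.η)⁻¹) →
          (∀ y τ, (∀ j, j ≤ m → ¬ SideTouches (i.Ω j) y τ) → A' y τ = 0) →
          msup L m i.η (-(1 : ℝ)) (fun j (b : Site d × Fin d) => SideTouches (i.Ω j) b.1 b.2) (fun b => A' b.1 b.2)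
          ≤ B₀ * (bondNorm L m i.η (-(3 : ℝ)) i.Ω (fun x μ => Jcur i.η U₀ A' μ x)
          + wsup 1 (fun p : {p : ℕ × (Site d × Fin d) // p.1 ≤ m ∧ p.2 ∈ towerBondsP L i.Ω (i.Λs m) p.1} =>
          linCovIter L U₀ (iEta i.η A') p.1.1 p.1.2.1 p.1.2.2)) + γ' * B₀ * (α₀ + α₁) ∧
          msup L m i.η (-(2 : ℝ)) (fun j (t : Fin d × Fin d × Site d) => SideTouches (i.Ω j) t.2.2 t.2.1)
          (fun t => covDerivFwd i.η U₀ t.1 (fun z => A' z t.2.1) t.2.2)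
          ≤ B₀ * (bondNorm L m i.η (-(3 : ℝ)) i.Ω (fun x μ => Jcur i.η U₀ A' μ x)
          + wsup 1 (fun p : {p : ℕ × (Site d × Fin d) // p.1 ≤ m ∧ p.2 ∈ towerBondsP L i.Ω (i.Λs m) p.1} =>
          linCovIter L U₀ (iEta i.η A') p.1.1 p.1.2.1 p.1.2.2)) + γ' * B₀ * (α₀ + α₁))) →
      -- T5's `SP5u` binder text at `(i, P)`
      ∀ α₀ α₁ : ℝ, 0 < α₀ → 0 < α₁ → α₀ + α₁ ≤ cP →
        ∀ U₀ U' : Site d → Fin d → 𝔸ˣ, (∀ x κ, U₀ x κ ∈ unitaryUnits 𝔸) → (∀ x κ, U' x κ ∈ unitaryUnits 𝔸) →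
        IsPeriodic P U₀ → IsPeriodic P U' → ∀ φ : Φ, Adm φ U₀ α₀ α₁ →
        InAk L i.k i.η α₀ i.Ω U₀ → InAk L i.k i.η α₀ i.Ω (mulCfg U' U₀) → (∀ m, m ≤ i.k → InAx L m (i.Λs m) U₀ (mulCfg U' U₀)) →
        (∀ j, j ≤ i.k → ∀ (z : Site d) (μ : Fin d),
          ((∀ x, InBox (tlo L z j) (thi L z j) x → x ∈ i.Ω j) ∨ (∀ x, InBox (tlo L (z + e μ) j) (thi L (z + e μ) j) x → x ∈ i.Ω j)) →
          ‖(avgIter L (mulCfg U' U₀) j z μ : 𝔸) - (avgIter L U₀ j z μ : 𝔸)‖ ≤ α₁) →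
        (∀ b ∈ {b : Site d × Fin d | SideTouches (i.Ω 0) b.1 b.2}, ‖((U' b.1 b.2 : 𝔸ˣ) : 𝔸) - 1‖ ≤ α₁) →
        ∀ u₁ : Site d → 𝔸ˣ, (∀ x, u₁ x ∈ unitaryUnits 𝔸) → (∀ x, x ∉ i.Ω 0 → u₁ x = 1) → IsPeriodic P u₁ → Restr129 L i.k (i.Λs i.k) U₀ u₁ →
        LanF U₀ φ i.k (mgauge U₀ u₁⁻¹ U') →
        (∃ A₁ : Site d → Fin d → 𝔸, ∀ j, j ≤ i.k → ∀ (x : Site d) (κ : Fin d), SideTouches (i.Ω j) x κ →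
          mgauge U₀ u₁⁻¹ U' x κ = cfgExp i.η A₁ x κ ∧ ‖A₁ x κ‖ ≤ (5 * (d : ℝ) * L * B₈ * (α₀ + α₁)) * ((L : ℝ) ^ j * i.η)⁻¹) →
        ∀ (v w : Site d → 𝔸ˣ) (lam mu : Site d → 𝔸),
        IsPeriodic P v → IsPeriodic P w → IsPeriodic P lam → IsPeriodic P mu →
        (∀ x, ((gaugeExp lam x : 𝔸ˣ) : 𝔸) = ((v x : 𝔸ˣ) : 𝔸) ∧ IsSelfAdjoint (lam x) ∧ ‖lam x‖ < cu) → (∀ x, x ∉ i.Ω 0 → lam x = 0) →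
        (∀ j, j ≤ i.k → ∀ b ∈ {b : Site d × Fin d | SideTouches (i.Ω j) b.1 b.2}, ((L : ℝ) ^ j * i.η) * ‖covDerivFwd i.η U₀ b.2 lam b.1‖ < cu) →
        (∀ x, ((gaugeExp mu x : 𝔸ˣ) : 𝔸) = ((w x : 𝔸ˣ) : 𝔸) ∧ IsSelfAdjoint (mu x) ∧ ‖mu x‖ < cu) → (∀ x, x ∉ i.Ω 0 → mu x = 0) →
        (∀ j, j ≤ i.k → ∀ b ∈ {b : Site d × Fin d | SideTouches (i.Ω j) b.1 b.2}, ((L : ℝ) ^ j * i.η) * ‖covDerivFwd i.η U₀ b.2 mu b.1‖ < cu) →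
        LanF U₀ φ i.k (mgauge U₀ v⁻¹ (mgauge U₀ u₁⁻¹ U')) → Restr129 L i.k (i.Λs i.k) U₀ (u₁ * v) →
        LanF U₀ φ i.k (mgauge U₀ w⁻¹ (mgauge U₀ u₁⁻¹ U')) → Restr129 L i.k (i.Λs i.k) U₀ (u₁ * w) →
        ∀ x, v x = w x := by
  have hL1 : 1 ≤ L := le_trans (by norm_num) hL
  have hd1 : 1 ≤ d := le_trans (by norm_num) hd2
  have hB₈ : 0 < B₈ := lt_of_lt_of_le hB₀ hB₀8
  -- the uniqueness windows at source size `γ` (member-uniform): radius `α₄`, domain `c_u`, threshold `c_W`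
  obtain ⟨α₄, cu, cW, hα₄, hcu, hcW, hW⟩ := uniqWindows_of_guard_src hd1 hL1 hB₈ hB hB₀'H hB₂' hBG hBR hγ
  -- EDITION γ: the five γ windows from one more member-uniform threshold `c_γ(d, L, B₈)`
  obtain ⟨cγ, hcγ, hWγ⟩ := gammaWindows_of_guard (d := d) hd1 hL1 hB₈
  refine ⟨cu, min cW (min cL (min c59 cγ)), hcu, lt_min hcW (lt_min hcL (lt_min hc59 hcγ)), ?_⟩
  intro i P Φ Adm LanF src hAdm hLan146 hΩ0 hPdiv hΛ SLetUBper SH59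
  have hPW : min cW (min cL (min c59 cγ)) ≤ cW := min_le_left _ _
  have hPL : min cW (min cL (min c59 cγ)) ≤ cL := (min_le_right _ _).trans (min_le_left _ _)
  have hP59 : min cW (min cL (min c59 cγ)) ≤ c59 := (min_le_right _ _).trans ((min_le_right _ _).trans (min_le_left _ _))
  have hPγ : min cW (min cL (min c59 cγ)) ≤ cγ := (min_le_right _ _).trans ((min_le_right _ _).trans (min_le_right _ _))
  exact sp5u_of_lettersUB_src_γ'_per hd2 hL i.hη i.hk P i.hΩ hΩ0 (B8TowerBondsPrinted.ZdIdx.towerBondsP_laws i).1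
    (B8TowerBondsPrinted.ZdIdx.towerBondsP_laws i).2 i.htower hPdiv hΛ hB₀ hB₀' hB₀'H hB₂' hBG hBR hγ hγ' hB₀8 hγB hα₄ SLetUBper hPL Adm LanF src hAdm
    hLan146 (fun α₀ α₁ hα₀ hα₁ hs => SH59 α₀ α₁ hα₀ hα₁ (hs.trans hP59)) (fun α₀ α₁ hα₀ hα₁ hs => hW α₀ α₁ hα₀ hα₁ (hs.trans hPW))
    (fun α₀ α₁ hα₀ hα₁ hs => hWγ α₀ α₁ hα₀ hα₁ (hs.trans hPγ))

end Server

#print axioms sp5u_of_lettersUB_src_γ'_per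
#print axioms sockP5uSrcPer_of_lettersAtPerNested

end Literature.MathematicalPhysics.QuantumFieldTheory.Balaban1983to89.B8SockSP5uNestedSrcPer

end
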